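import Summits.RiemannHypothesis.RiemannHypothesis.Theorems.IntegerScrewCensusFloor96C

/-!
# Route `IntegerScrew` — census cell `M096-T375-dd` in the kernel: the DUAL checker on the cells `77 ≤ c < 94` (part D)

KERNEL FACTS (`decide +kernel`): `dualCheckW 95 375 40 EB 6000 a b … = true` on sub-ranges of `[77, 94)` for the dual
certificate literal `dpats96/deps96` of `IntegerScrewCensusFloor96A`.  RH-free; nothing here bears on the truth of RH.
-/

set_option linter.dupNamespace false
set_option autoImplicit false

namespace Summit.RiemannHypothesis.RiemannHypothesis.Theorems.IntegerScrew.Manifest.Fast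

open Literature.Analysis.ValidatedNumerics Literature.Analysis.ValidatedNumerics.Numerics

set_option maxRecDepth 200000 in
set_option maxHeartbeats 0 in
/-- KERNEL FACT: the cells `77 ≤ c < 88` pass. -/
theorem dualCheckW_96_77_88 : dualCheckW 95 375 40 EB 6000 77 88 logs113s dpats96 deps96 = true := by
  decide +kernel

set_option maxRecDepth 200000 in
set_option maxHeartbeats 0 in
/-- KERNEL FACT: the cells `88 ≤ c < 94` pass. -/
theorem dualCheckW_96_88_94 : dualCheckW 95 375 40 EB 6000 88 94 logs113s dpats96 deps96 = true := by
  decide +kernel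

/-- The cells `0 ≤ c < 22` pass. -/
theorem dualCheckW_96_0_22j : dualCheckW 95 375 40 EB 6000 0 22 logs113s dpats96 deps96 = true :=
  dualCheckW_join (by norm_num) (by norm_num) dualCheckW_96_0_11 dualCheckW_96_11_22

/-- The cells `0 ≤ c < 33` pass. -/
theorem dualCheckW_96_0_33j : dualCheckW 95 375 40 EB 6000 0 33 logs113s dpats96 deps96 = true :=
  dualCheckW_join (by norm_num) (by norm_num) dualCheckW_96_0_22j dualCheckW_96_22_33

/-- The cells `0 ≤ c < 44` pass. -/
theorem dualCheckW_96_0_44j : dualCheckW 95 375 40 EB 6000 0 44 logs113s dpats96 deps96 = true :=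
  dualCheckW_join (by norm_num) (by norm_num) dualCheckW_96_0_33j dualCheckW_96_33_44

/-- The cells `0 ≤ c < 55` pass. -/
theorem dualCheckW_96_0_55j : dualCheckW 95 375 40 EB 6000 0 55 logs113s dpats96 deps96 = true :=
  dualCheckW_join (by norm_num) (by norm_num) dualCheckW_96_0_44j dualCheckW_96_44_55

/-- The cells `0 ≤ c < 66` pass. -/
theorem dualCheckW_96_0_66j : dualCheckW 95 375 40 EB 6000 0 66 logs113s dpats96 deps96 = true :=
  dualCheckW_join (by norm_num) (by norm_num) dualCheckW_96_0_55j dualCheckW_96_55_66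

/-- The cells `0 ≤ c < 77` pass. -/
theorem dualCheckW_96_0_77j : dualCheckW 95 375 40 EB 6000 0 77 logs113s dpats96 deps96 = true :=
  dualCheckW_join (by norm_num) (by norm_num) dualCheckW_96_0_66j dualCheckW_96_66_77

/-- The cells `0 ≤ c < 88` pass. -/
theorem dualCheckW_96_0_88j : dualCheckW 95 375 40 EB 6000 0 88 logs113s dpats96 deps96 = true :=
  dualCheckW_join (by norm_num) (by norm_num) dualCheckW_96_0_77j dualCheckW_96_77_88

/-- The cells `0 ≤ c < 94` pass. -/
theorem dualCheckW_96 : dualCheckW 95 375 40 EB 6000 0 94 logs113s dpats96 deps96 = true :=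
  dualCheckW_join (by norm_num) (by norm_num) dualCheckW_96_0_88j dualCheckW_96_88_94

/-- **`T_DD(96) > 375`**: NO manifest certificate of `S_96` with frequencies in `[1/10, 375]` exists (census floor,
refuted side, by the dual certificate). -/
theorem censusFloor_96 : ¬ ManifestCert 95 (1 / 10) 375 := by
  have h := not_manifestCert_of_check dualLight_96 dualCheckW_96 size_96 (fun m h2 hm => logs113s_mem m h2 (by omega))
    (utabNN_ok (by norm_num)) CL10000_le le_CH10000
  exact_mod_cast h

end Summit.RiemannHypothesis.RiemannHypothesis.Theorems.IntegerScrew.Manifest.Fast
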